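/-
  Summits/AtomisticToContinuum/Crystallization/Theorems/OverbindingBudgetAffineFarLabelDrift.lean

  residual stmt-AtomisticToContinuum-31280 · slot Z `FarAggregatePricing 12 (1/25) (1/2000) (1/(2·10⁷))` · the L-slot, leaf SM = LAB ∧ DRIFT
  (…FarMatchingSplit p845178): ★ DRIFT `LabelDriftBound` PROVED OUTRIGHT (critic row 866 (vi)); decomp-a2c lens-4 «minimal counterexample /
  extremal reduction», generation 55.  0 sorry · 0 axiom · no instance · no notation · no option.
-/
import Summits.AtomisticToContinuum.Crystallization.Theorems.OverbindingBudgetAffineFarMatchingSplit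
import Summits.AtomisticToContinuum.Crystallization.Theorems.OverbindingBudgetAffineFarShellCovering

/-! # DRIFT `LabelDriftBound` holds: integrating local affine fits over a labelled close packing

THE STATEMENT (tree, `…FarMatchingSplit`).  `LabelDriftBound`: there is an absolute `D₀` such that for every Hägg sequence `s`, every
labelling `π : M → barlowStacking 1 √(2/3) s` which is injective, exhaustive below radius `ρ` (`‖p‖ ≤ ρ ⇒ p = π k` for some `k ∈ M`),
based (`π i = 0`), and every family of local affine fits `L k` with defect `η` on label-radius `2` around every interior label
(`‖π k‖ + 2 ≤ ρ`), the fit at the base controls every interior site: `‖y k − y i − L i (π k)‖ ≤ D₀ · η · (1 + ‖π k‖²)`.  We prove it with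
`D₀ = 400` (`labelDriftBound_holds`).

THE PROOF (the lens at label level: a minimal counterexample would be an interior label of least norm violating the bound — but every
nonzero label has a touching label strictly closer to the base, and the bound propagates along that edge).
* §1 OPERATOR BOUND FROM THE FRAME (`norm_map_le_of_frame`): a linear map `A` of `ℝ³` with `‖A u₁‖, ‖A u₂‖, ‖A (σ w + 𝗁e₃)‖ ≤ b`
  (`u₁ = (2,0,0)`, `u₂ = (1,√3,0)`, `w = (u₁+u₂)/3`, `σ = ±1` — three vectors of the layer shell `layerShell σ σ'`, a basis of `ℝ³`)
  has `‖A x‖ ≤ 4 b ‖x‖` (coordinates; `√3, 𝗁 ≥ 1`).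
* §2 REALISED SHELLS (`shell_fit_compare`, `norm_map_sub_le_of_adjacent`): by Hales's shell theorem
  (`touching_barlowStacking_eq_image_barlowShell`) the twelve touching neighbours of a site `p` of the stacking in layer `m` are
  `p + barlowShell (s m) (−s (m−1)) ∋ p + u₁/2, p + u₂/2, p + (s m · w + 𝗁e₃)/2`; for an interior label they are LABELLED (exhaustive
  below `ρ`), so for two interior labels `k, k'` at label distance `≤ 1` three fits (at `k'` towards the neighbour, at `k` towards the
  neighbour, at `k` towards `k'`) give `‖(L k' − L k) x‖ ≤ 3η` on each half shell vector, hence `‖L k' − L k‖ ≤ 24η` by §1.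
* UNIFORM DESCENT (`exists_closer_neighbour` of `…FarShellCovering`): every site `p ≠ 0` of the stacking has a touching site `q`
  (`dist p q = 1`) with `‖q‖ ≤ ‖p‖ − 1/5` (the `45°` covering property of the layer shells and `‖p‖ ≥ 1`).
* §3 INDUCTION ON `⌈5‖π k‖⌉` (`labelDriftBound_holds`) with the invariant
  `‖L k − L i‖ ≤ 24η(5‖π k‖ + 1)` ∧ `‖y k − y i − L i(π k)‖ ≤ 400η(1 + ‖π k‖²)`: descend from `π k` to a labelled touching site `π k₁`
  (interior, norm `≤ ‖π k‖ − 1/5`), telescope `y k − y i − L i(π k) = [y k − y k₁ − L k₁(π k − π k₁)] + [y k₁ − y i − L i(π k₁)] +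
  [(L k₁ − L i)(π k − π k₁)]` (`≤ η + 400η(1 + ‖π k₁‖²) + 24η(5‖π k₁‖ + 1)`), and `17 ≤ 40‖π k‖`.
RECORDS: `shelteredMatching_of_labelling : ShelteredLabelling θ θ₀ → ShelteredMatching θ θ₀` (SM ⟸ LAB alone; the tree join
`shelteredMatching_of_labelling_drift` with DRIFT discharged), `nearFieldRechartLoss_of_labelling`, `defectLocality_of_labelling`.
So the leaf list of the slot loses DRIFT: v13 = Z2 `FarCoreExcess` · Zr‴a `ShelteredFarCharting` · Zr‴b `NormalCorePricing` · Z3a `TailDriftBound` ·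
LAB `ShelteredLabelling` (rank 2) · Z4″ `ScaleBadFloor` (the six-leaf slot record `farAggregatePricing_record_of_leaves_v13` :=
`farAggregatePricing_record_of_leaves_v12 … labelDriftBound_holds …` is in `…FarSlotRecord`, which imports `…FarCensusCharge` and this file).
HIDDEN-GAUGE / DEGENERATE AUDIT: `η = 0` ⇒ exact affine propagation (fine, conclusion `≤ 0` forces `y k − y i = L i (π k)`: correct, the fits
are then exact and the labelled graph is connected through touching edges); `M = {i}` ⇒ only `k = i` is interior-or-not, bound trivial; `ρ < 2` ⇒ no
interior label, vacuous; the injectivity of `π` is used only at the base (`π k = 0 ⇒ k = i`); no chart, no `y`-geometry, no `N`-dependence.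
-/

namespace Summit.AtomisticToContinuum.Crystallization.Theorems.OverbindingBudgetAffineFarSmoothSplit

open scoped BigOperators Classical RealInnerProductSpace
open Literature.MathematicalPhysics.StatisticalMechanics
open Literature.Geometry.DiscreteGeometry (layerSpacing layerSpacing_sq layerSpacing_pos layerShell hexagonSet holeTriple
  mem_layerShell_iff hexagonSet_subset_layerShell frameW_eq norm_sq_fin3 sqrt_three_sq)

/-! ## §1  An operator bound from three vectors of the close-packing frame (PROVED) -/

/-- Coordinates are bounded by the norm in `ℝ³`. [folklore] -/
theorem abs_apply_le_norm_fin3 (w : EuclideanSpace ℝ (Fin 3)) : |w 0| ≤ ‖w‖ ∧ |w 1| ≤ ‖w‖ ∧ |w 2| ≤ ‖w‖ := by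
  have h := norm_sq_fin3 w
  refine ⟨abs_le_of_sq_le_sq ?_ (norm_nonneg w), abs_le_of_sq_le_sq ?_ (norm_nonneg w),
    abs_le_of_sq_le_sq ?_ (norm_nonneg w)⟩ <;>
    nlinarith [sq_nonneg (w 0), sq_nonneg (w 1), sq_nonneg (w 2)]

/-- **OPERATOR BOUND FROM THE FRAME (PROVED).** If a linear map `A` of `ℝ³` has norm `≤ b` on the three layer-shell vectors
`u₁ = (2,0,0)`, `u₂ = (1,√3,0)` and `σ w + 𝗁 e₃` (`σ = ±1`), then `‖A x‖ ≤ 4 b ‖x‖` for all `x`. [this file] -/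
theorem norm_map_le_of_frame (A : EuclideanSpace ℝ (Fin 3) →ₗ[ℝ] EuclideanSpace ℝ (Fin 3)) {σ b : ℝ}
    (hσ : σ = 1 ∨ σ = -1) (hu : ‖A (triangularVec₁ 2)‖ ≤ b) (hv : ‖A (triangularVec₂ 2)‖ ≤ b)
    (he : ‖A (σ • barlowOffset 2 + layerNormal layerSpacing)‖ ≤ b) (w : EuclideanSpace ℝ (Fin 3)) :
    ‖A w‖ ≤ 4 * b * ‖w‖ := by
  have hb : 0 ≤ b := (norm_nonneg _).trans hu
  have h3 : Real.sqrt 3 ^ 2 = 3 := sqrt_three_sq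
  have hs3 : 1 ≤ Real.sqrt 3 := by nlinarith [Real.sqrt_nonneg 3]
  have hs0 : (0 : ℝ) < Real.sqrt 3 := by linarith
  have hh2 : layerSpacing ^ 2 = 8 / 3 := layerSpacing_sq
  have hh0 : (0 : ℝ) < layerSpacing := layerSpacing_pos
  have hh1 : 1 ≤ layerSpacing := by nlinarith
  obtain ⟨hw0, hw1, hw2⟩ := abs_apply_le_norm_fin3 w
  -- coordinates of `w` along `u₁, u₂, 𝗁e₃`
  have hw : w = ((w 0 - w 1 / Real.sqrt 3) / 2) • triangularVec₁ 2 + (w 1 / Real.sqrt 3) • triangularVec₂ 2 +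
      (w 2 / layerSpacing) • layerNormal layerSpacing := by
    have hhne : layerSpacing ≠ 0 := hh0.ne'
    have hsne : Real.sqrt 3 ≠ 0 := hs0.ne'
    ext n
    fin_cases n
    · simp
    · simp
    · simp; field_simp
  -- the three images
  have hAo : ‖A (barlowOffset 2)‖ ≤ 2 / 3 * b := by
    rw [frameW_eq, map_smul, map_add, norm_smul, Real.norm_of_nonneg (by norm_num : (0 : ℝ) ≤ 1 / 3)]
    linarith [norm_add_le (A (triangularVec₁ 2)) (A (triangularVec₂ 2))]
  have hσ1 : ‖σ‖ = 1 := by rcases hσ with rfl | rfl <;> simp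
  have hAe : ‖A (layerNormal layerSpacing)‖ ≤ 5 / 3 * b := by
    have e : A (layerNormal layerSpacing) = A (σ • barlowOffset 2 + layerNormal layerSpacing) - σ • A (barlowOffset 2) := by
      rw [map_add, map_smul]; abel
    rw [e]
    calc ‖A (σ • barlowOffset 2 + layerNormal layerSpacing) - σ • A (barlowOffset 2)‖
        ≤ ‖A (σ • barlowOffset 2 + layerNormal layerSpacing)‖ + ‖σ • A (barlowOffset 2)‖ := norm_sub_le _ _
      _ ≤ b + 2 / 3 * b := by rw [norm_smul, hσ1, one_mul]; linarith
      _ = 5 / 3 * b := by ring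
  have h1 : ‖((w 0 - w 1 / Real.sqrt 3) / 2) • A (triangularVec₁ 2)‖ ≤ (|w 0| + |w 1|) / 2 * b := by
    rw [norm_smul, Real.norm_eq_abs]
    have hc : |w 1 / Real.sqrt 3| ≤ |w 1| := by
      rw [abs_div, abs_of_pos hs0]
      exact div_le_self (abs_nonneg _) hs3
    have : |(w 0 - w 1 / Real.sqrt 3) / 2| ≤ (|w 0| + |w 1|) / 2 := by
      rw [abs_div, abs_two]
      linarith [abs_sub (w 0) (w 1 / Real.sqrt 3)]
    exact mul_le_mul this hu (norm_nonneg _) (by positivity)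
  have h2 : ‖(w 1 / Real.sqrt 3) • A (triangularVec₂ 2)‖ ≤ |w 1| * b := by
    rw [norm_smul, Real.norm_eq_abs, abs_div, abs_of_pos hs0]
    exact mul_le_mul (div_le_self (abs_nonneg _) hs3) hv (norm_nonneg _) (abs_nonneg _)
  have h3' : ‖(w 2 / layerSpacing) • A (layerNormal layerSpacing)‖ ≤ |w 2| * (5 / 3 * b) := by
    rw [norm_smul, Real.norm_eq_abs, abs_div, abs_of_pos hh0]
    exact mul_le_mul (div_le_self (abs_nonneg _) hh1) hAe (norm_nonneg _) (abs_nonneg _)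
  have hAw : A w = ((w 0 - w 1 / Real.sqrt 3) / 2) • A (triangularVec₁ 2) + (w 1 / Real.sqrt 3) • A (triangularVec₂ 2) +
      (w 2 / layerSpacing) • A (layerNormal layerSpacing) := by
    conv_lhs => rw [hw]
    simp only [map_add, map_smul]
  rw [hAw]
  calc ‖((w 0 - w 1 / Real.sqrt 3) / 2) • A (triangularVec₁ 2) + (w 1 / Real.sqrt 3) • A (triangularVec₂ 2) +
          (w 2 / layerSpacing) • A (layerNormal layerSpacing)‖
      ≤ ‖((w 0 - w 1 / Real.sqrt 3) / 2) • A (triangularVec₁ 2) + (w 1 / Real.sqrt 3) • A (triangularVec₂ 2)‖ +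
          ‖(w 2 / layerSpacing) • A (layerNormal layerSpacing)‖ := norm_add_le _ _
    _ ≤ ‖((w 0 - w 1 / Real.sqrt 3) / 2) • A (triangularVec₁ 2)‖ + ‖(w 1 / Real.sqrt 3) • A (triangularVec₂ 2)‖ +
          ‖(w 2 / layerSpacing) • A (layerNormal layerSpacing)‖ := by gcongr; exact norm_add_le _ _
    _ ≤ (|w 0| + |w 1|) / 2 * b + |w 1| * b + |w 2| * (5 / 3 * b) := by linarith
    _ ≤ 4 * b * ‖w‖ := by
      nlinarith [mul_le_mul_of_nonneg_left hw0 hb, mul_le_mul_of_nonneg_left hw1 hb, mul_le_mul_of_nonneg_left hw2 hb,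
        abs_nonneg (w 0), abs_nonneg (w 1), abs_nonneg (w 2), norm_nonneg w]

/-! ## §2  Realised shells: comparing two local fits at touching labels (PROVED) -/

/-- **THREE FITS ON A SHELL VECTOR (PROVED).** For interior labels `k, k'` at label distance `≤ 1` and a shell vector `x` of the site
`π k'` (so that `π k' + x` is a labelled touching site), `‖L k' x − L k x‖ ≤ 3η`. [this file] -/
theorem shell_fit_compare {s : ℤ → ℤ} (hs : IsHaggSeq s) {N : ℕ} {y π : Fin N → EuclideanSpace ℝ (Fin 3)}
    {M : Finset (Fin N)} {ρ η : ℝ} {L : Fin N → (EuclideanSpace ℝ (Fin 3) →ₗ[ℝ] EuclideanSpace ℝ (Fin 3))}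
    (hsurj : ∀ p ∈ barlowStacking 1 (Real.sqrt (2 / 3)) s, ‖p‖ ≤ ρ → ∃ k ∈ M, π k = p)
    (hfit : ∀ k ∈ M, ‖π k‖ + 2 ≤ ρ → ∀ k' ∈ M, ‖π k' - π k‖ ≤ 2 → ‖y k' - y k - L k (π k' - π k)‖ ≤ η)
    {k k' : Fin N} (hk : k ∈ M) (hk' : k' ∈ M) (hkρ : ‖π k‖ + 2 ≤ ρ) (hk'ρ : ‖π k'‖ + 2 ≤ ρ)
    (hkk' : ‖π k' - π k‖ ≤ 1) {m a b : ℤ} (hp : π k' = barlowPos 1 (Real.sqrt (2 / 3)) s m a b)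
    {x : EuclideanSpace ℝ (Fin 3)} (hx : x ∈ barlowShell ((s m : ℤ) : ℝ) (-((s (m - 1) : ℤ) : ℝ))) :
    ‖L k' x - L k x‖ ≤ 3 * η := by
  have hmem : π k' + x ∈ {z | z ∈ barlowStacking 1 (Real.sqrt (2 / 3)) s ∧
      dist z (barlowPos 1 (Real.sqrt (2 / 3)) s m a b) = 1} := by
    rw [touching_barlowStacking_eq_image_barlowShell hs m a b, ← hp]
    exact ⟨x, hx, rfl⟩
  obtain ⟨hS, hd⟩ := hmem
  rw [← hp, dist_eq_norm, add_sub_cancel_left] at hd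
  obtain ⟨n, hn, hπn⟩ := hsurj _ hS (by linarith [norm_add_le (π k') x])
  have f1 := hfit k' hk' hk'ρ n hn (by rw [hπn, add_sub_cancel_left]; linarith)
  have f2 := hfit k hk hkρ n hn (by
    rw [hπn, show π k' + x - π k = x + (π k' - π k) by abel]
    linarith [norm_add_le x (π k' - π k)])
  have f3 := hfit k hk hkρ k' hk' (by linarith)
  rw [hπn, add_sub_cancel_left] at f1
  have e : L k' x - L k x =
      (y n - y k - L k (π n - π k)) - (y k' - y k - L k (π k' - π k)) - (y n - y k' - L k' x) := by
    rw [hπn, show π k' + x - π k = x + (π k' - π k) by abel, map_add]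
    abel
  rw [e]
  calc ‖(y n - y k - L k (π n - π k)) - (y k' - y k - L k (π k' - π k)) - (y n - y k' - L k' x)‖
      ≤ ‖(y n - y k - L k (π n - π k)) - (y k' - y k - L k (π k' - π k))‖ + ‖y n - y k' - L k' x‖ := norm_sub_le _ _
    _ ≤ ‖y n - y k - L k (π n - π k)‖ + ‖y k' - y k - L k (π k' - π k)‖ + ‖y n - y k' - L k' x‖ := by
        gcongr; exact norm_sub_le _ _
    _ ≤ η + η + η := by gcongr
    _ = 3 * η := by ring

/-- **TOUCHING LABELS HAVE CLOSE FITS (PROVED).** For interior labels `k, k'` with `‖π k' − π k‖ ≤ 1`: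
`‖L k' w − L k w‖ ≤ 24 η ‖w‖` for all `w` (three realised half shell vectors `u₁/2, u₂/2, (s m · w + 𝗁e₃)/2` of the site `π k'`,
`shell_fit_compare`, and the frame operator bound). [this file] -/
theorem norm_map_sub_le_of_adjacent {s : ℤ → ℤ} (hs : IsHaggSeq s) {N : ℕ} {y π : Fin N → EuclideanSpace ℝ (Fin 3)}
    {M : Finset (Fin N)} {ρ η : ℝ} {L : Fin N → (EuclideanSpace ℝ (Fin 3) →ₗ[ℝ] EuclideanSpace ℝ (Fin 3))}
    (hbar : ∀ k ∈ M, π k ∈ barlowStacking 1 (Real.sqrt (2 / 3)) s ∧ ‖π k‖ ≤ ρ)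
    (hsurj : ∀ p ∈ barlowStacking 1 (Real.sqrt (2 / 3)) s, ‖p‖ ≤ ρ → ∃ k ∈ M, π k = p)
    (hfit : ∀ k ∈ M, ‖π k‖ + 2 ≤ ρ → ∀ k' ∈ M, ‖π k' - π k‖ ≤ 2 → ‖y k' - y k - L k (π k' - π k)‖ ≤ η)
    {k k' : Fin N} (hk : k ∈ M) (hk' : k' ∈ M) (hkρ : ‖π k‖ + 2 ≤ ρ) (hk'ρ : ‖π k'‖ + 2 ≤ ρ)
    (hkk' : ‖π k' - π k‖ ≤ 1) (w : EuclideanSpace ℝ (Fin 3)) :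
    ‖L k' w - L k w‖ ≤ 24 * η * ‖w‖ := by
  obtain ⟨m, a, b, hp⟩ := (hbar k' hk').1
  have hσ : ((s m : ℤ) : ℝ) = 1 ∨ ((s m : ℤ) : ℝ) = -1 := by
    rcases hs m with h | h <;> simp [h]
  have two0 : (2 : ℝ) ≠ 0 := two_ne_zero
  have hxu : (2 : ℝ)⁻¹ • triangularVec₁ (2 : ℝ) ∈ barlowShell ((s m : ℤ) : ℝ) (-((s (m - 1) : ℤ) : ℝ)) := by
    rw [mem_barlowShell_iff, smul_inv_smul₀ two0]
    exact hexagonSet_subset_layerShell _ _ (by simp [hexagonSet])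
  have hxv : (2 : ℝ)⁻¹ • triangularVec₂ (2 : ℝ) ∈ barlowShell ((s m : ℤ) : ℝ) (-((s (m - 1) : ℤ) : ℝ)) := by
    rw [mem_barlowShell_iff, smul_inv_smul₀ two0]
    exact hexagonSet_subset_layerShell _ _ (by simp [hexagonSet])
  have hxe : (2 : ℝ)⁻¹ • (((s m : ℤ) : ℝ) • barlowOffset (2 : ℝ) + layerNormal layerSpacing) ∈
      barlowShell ((s m : ℤ) : ℝ) (-((s (m - 1) : ℤ) : ℝ)) := by
    rw [mem_barlowShell_iff, smul_inv_smul₀ two0, mem_layerShell_iff]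
    exact Or.inr (Or.inl (by simp [holeTriple]))
  have key : ∀ X : EuclideanSpace ℝ (Fin 3),
      (2 : ℝ)⁻¹ • X ∈ barlowShell ((s m : ℤ) : ℝ) (-((s (m - 1) : ℤ) : ℝ)) → ‖(L k' - L k) X‖ ≤ 6 * η := by
    intro X hX
    have h := shell_fit_compare hs hsurj hfit hk hk' hkρ hk'ρ hkk' hp hX
    have hX2 : X = (2 : ℝ) • ((2 : ℝ)⁻¹ • X) := by rw [smul_inv_smul₀ two0]
    have e : (L k' - L k) X = (2 : ℝ) • (L k' ((2 : ℝ)⁻¹ • X) - L k ((2 : ℝ)⁻¹ • X)) := by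
      conv_lhs => rw [hX2]
      rw [map_smul, LinearMap.sub_apply]
    rw [e, norm_smul, Real.norm_two]
    linarith
  have hop := norm_map_le_of_frame (L k' - L k) hσ (key _ hxu) (key _ hxv) (key _ hxe) w
  rw [LinearMap.sub_apply] at hop
  linarith

/-! ## §3  ★ DRIFT holds (PROVED) -/

/-- ★ **DRIFT `LabelDriftBound` HOLDS (PROVED, `D₀ = 400`).**  Induction on `⌈5‖π k‖⌉` along the uniform descent
(`exists_closer_neighbour`) with the invariant `‖L k − L i‖ ≤ 24η(5‖π k‖ + 1)` (§2) and `‖y k − y i − L i(π k)‖ ≤ 400η(1 + ‖π k‖²)` (telescoping). [this file] -/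
theorem labelDriftBound_holds : LabelDriftBound := by
  refine ⟨400, by norm_num, ?_⟩
  intro s hs N y i M π ρ η L hη hi hπi hinj hbar hsurj hfit
  have h0S : (0 : EuclideanSpace ℝ (Fin 3)) ∈ barlowStacking 1 (Real.sqrt (2 / 3)) s := hπi ▸ (hbar i hi).1
  -- the base label
  have base : ∀ k ∈ M, π k = 0 →
      (∀ w, ‖L k w - L i w‖ ≤ 24 * η * (5 * ‖π k‖ + 1) * ‖w‖) ∧ ‖y k - y i - L i (π k)‖ ≤ 400 * η * (1 + ‖π k‖ ^ 2) := by
    intro k hk hk0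
    have hki : k = i := hinj hk hi (by rw [hk0, hπi])
    subst hki
    refine ⟨fun w => ?_, ?_⟩
    · rw [sub_self, norm_zero]
      exact mul_nonneg (mul_nonneg (mul_nonneg (by norm_num) hη) (by positivity)) (norm_nonneg w)
    · rw [hk0, map_zero, sub_self, sub_zero, norm_zero]
      exact mul_nonneg (mul_nonneg (by norm_num) hη) (by positivity)
  -- induction on `⌈5‖π k‖⌉`
  have P : ∀ n : ℕ, ∀ k ∈ M, ‖π k‖ + 2 ≤ ρ → ‖π k‖ ≤ (n : ℝ) / 5 →
      (∀ w, ‖L k w - L i w‖ ≤ 24 * η * (5 * ‖π k‖ + 1) * ‖w‖) ∧ ‖y k - y i - L i (π k)‖ ≤ 400 * η * (1 + ‖π k‖ ^ 2) := by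
    intro n
    induction n with
    | zero =>
      intro k hk hkρ hkn
      have h0 : ‖π k‖ ≤ 0 := by simpa using hkn
      exact base k hk (norm_le_zero_iff.1 h0)
    | succ n ih =>
      intro k hk hkρ hkn
      by_cases hk0 : π k = 0
      · exact base k hk hk0
      obtain ⟨q, hqS, hdist, hq⟩ := exists_closer_neighbour hs (hbar k hk).1 h0S hk0
      obtain ⟨k₁, hk₁, hπk₁⟩ := hsurj q hqS (by linarith [norm_nonneg q])
      have hk₁ρ : ‖π k₁‖ + 2 ≤ ρ := by rw [hπk₁]; linarith
      have hk₁n : ‖π k₁‖ ≤ (n : ℝ) / 5 := by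
        rw [hπk₁]; push_cast at hkn; linarith
      obtain ⟨ih1, ih2⟩ := ih k₁ hk₁ hk₁ρ hk₁n
      have hd1 : ‖π k - π k₁‖ = 1 := by rw [hπk₁, ← dist_eq_norm, hdist]
      have h1 : 1 ≤ ‖π k‖ := by
        have := le_dist_of_mem_barlowStacking_ideal hs one_pos
          (by rw [Real.sq_sqrt (by norm_num : (0 : ℝ) ≤ 2 / 3)]; norm_num) (hbar k hk).1 h0S hk0
        rwa [dist_zero_right] at this
      have LC := norm_map_sub_le_of_adjacent hs hbar hsurj hfit hk₁ hk hk₁ρ hkρ hd1.le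
      refine ⟨fun w => ?_, ?_⟩
      · have hηw : 0 ≤ 24 * η * ‖w‖ := mul_nonneg (mul_nonneg (by norm_num) hη) (norm_nonneg w)
        have h5 : 5 * ‖π k₁‖ + 2 ≤ 5 * ‖π k‖ + 1 := by rw [hπk₁]; linarith
        calc ‖L k w - L i w‖ ≤ ‖L k w - L k₁ w‖ + ‖L k₁ w - L i w‖ := norm_sub_le_norm_sub_add_norm_sub _ _ _
          _ ≤ 24 * η * ‖w‖ + 24 * η * (5 * ‖π k₁‖ + 1) * ‖w‖ := add_le_add (LC w) (ih1 w)
          _ = 24 * η * ‖w‖ * (5 * ‖π k₁‖ + 2) := by ring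
          _ ≤ 24 * η * ‖w‖ * (5 * ‖π k‖ + 1) := mul_le_mul_of_nonneg_left h5 hηw
          _ = 24 * η * (5 * ‖π k‖ + 1) * ‖w‖ := by ring
      · have T1 := hfit k₁ hk₁ hk₁ρ k hk (by linarith [hd1.le])
        have ih1' := ih1 (π k - π k₁)
        have e : y k - y i - L i (π k) =
            (y k - y k₁ - L k₁ (π k - π k₁)) + (y k₁ - y i - L i (π k₁)) + (L k₁ (π k - π k₁) - L i (π k - π k₁)) := by
          simp only [map_sub]; abel
        rw [e]
        have hq0 := norm_nonneg q
        have hq2 : ‖q‖ ^ 2 ≤ (‖π k‖ - 1 / 5) ^ 2 := pow_le_pow_left₀ hq0 hq 2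
        have key : 1 + 400 * (1 + ‖q‖ ^ 2) + 24 * (5 * ‖q‖ + 1) ≤ 400 * (1 + ‖π k‖ ^ 2) := by
          nlinarith [hq, hq2, h1, hq0]
        have key' := mul_le_mul_of_nonneg_left key hη
        calc ‖(y k - y k₁ - L k₁ (π k - π k₁)) + (y k₁ - y i - L i (π k₁)) + (L k₁ (π k - π k₁) - L i (π k - π k₁))‖
            ≤ ‖(y k - y k₁ - L k₁ (π k - π k₁)) + (y k₁ - y i - L i (π k₁))‖ + ‖L k₁ (π k - π k₁) - L i (π k - π k₁)‖ :=
              norm_add_le _ _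
          _ ≤ ‖y k - y k₁ - L k₁ (π k - π k₁)‖ + ‖y k₁ - y i - L i (π k₁)‖ + ‖L k₁ (π k - π k₁) - L i (π k - π k₁)‖ := by
              gcongr; exact norm_add_le _ _
          _ ≤ η + 400 * η * (1 + ‖π k₁‖ ^ 2) + 24 * η * (5 * ‖π k₁‖ + 1) * ‖π k - π k₁‖ := by gcongr
          _ = η * (1 + 400 * (1 + ‖q‖ ^ 2) + 24 * (5 * ‖q‖ + 1)) := by rw [hd1, hπk₁]; ring
          _ ≤ η * (400 * (1 + ‖π k‖ ^ 2)) := key'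
          _ = 400 * η * (1 + ‖π k‖ ^ 2) := by ring
  intro k hk hkρ
  exact (P ⌈5 * ‖π k‖⌉₊ k hk hkρ (by linarith [Nat.le_ceil (5 * ‖π k‖)])).2

/-! ## §4  Records: SM from LAB alone -/

/-- ★ **SM ⟸ LAB (PROVED join, DRIFT discharged)**: `ShelteredLabelling θ θ₀ → ShelteredMatching θ θ₀`. [this file] -/
theorem shelteredMatching_of_labelling {θ θ₀ : ℝ} (hL : ShelteredLabelling θ θ₀) : ShelteredMatching θ θ₀ :=
  shelteredMatching_of_labelling_drift hL labelDriftBound_holds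

/-- SM at the slot's constants from LAB alone. [this file] -/
theorem shelteredMatching_record_of_labelling (hL : ShelteredLabelling (1 / 25) (1 / 2000)) :
    ShelteredMatching (1 / 25) (1 / 2000) :=
  shelteredMatching_of_labelling hL

/-- NF ⟸ LAB (via SM). [this file] -/
theorem nearFieldRechartLoss_of_labelling {θ θ₀ : ℝ} (hL : ShelteredLabelling θ θ₀) : NearFieldRechartLoss θ θ₀ :=
  nearFieldRechartLoss_of_labelling_drift hL labelDriftBound_holds

/-- DL ⟸ LAB (via SM). [this file] -/
theorem defectLocality_of_labelling {θ θ₀ : ℝ} (hL : ShelteredLabelling θ θ₀) : DefectLocality θ θ₀ :=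
  defectLocality_of_labelling_drift hL labelDriftBound_holds

end Summit.AtomisticToContinuum.Crystallization.Theorems.OverbindingBudgetAffineFarSmoothSplit
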